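import Literature.MathematicalPhysics.QuantumFieldTheory.Balaban1983to89.Node00.CarriersB12Package

/-!
# NODE 00 (YM-PLAN Track A) — STAGE 3′(X.B12), SUCCESSOR DEVICE: PRINT's LEMMA 4 AS A FAMILY OVER ONE SCHEMATIC FRAME — the data-only `Lemma4Datum`, the product frame
# `frameOfFamily` with `lemma4Printed_frameOfFamily_iff`, and the family leaf `B12FamLeafOfRecord` over node00-def g32's objects of record (`IdxB12`, `ResidB12Run`,
# `F12OfRecord`, `B12LeafOfRecord`), knit from the companion's packages (`b12FamLeafOfRecord_of_packages`)

NODE 00 COMPANION MODULE, second tranche (seat `pub-ymgap-node00-def-B12` g0, 2026-08-26; director-ym LINE №72 (3); the LOCATED reading SAID in g32's `Node00/CarriersB12`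
header and AMEND-23 (B3): «the DAG leaf `b12` reads ONE instance `(k, j, □, X)` per run; print's Lemma 4 is the family» — this module types the successor device both seats
named: ONE `B12Sec2to5.Lemma4Frame` carrying the WHOLE printed range).  APPEND-ONLY: a NEW importing module; g32's `CarriersB12` ∕ `Record11CarriersB12`, this seat's
`CarriersB12Package`, lit-balaban p07's `B12Lemma4ConcreteFrame` untouched and CONSUMED BY NAME.  [Balaban1987RG1] = T. Bałaban, *Renormalization group approach to lattice
gauge field theories. I*, Commun. Math. Phys. **109** (1987) 249–301.

WHY.  `DagBinding.PrintedCarriers.F12` is ONE schematic frame per run and `B12Sec2to5.Lemma4Printed F c` speaks about that one frame, while print's Lemma 4 (3.53) is stated for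
every `k`, `1 ≤ j ≤ k`, `□ ∈ π_{k+1}`, `X ∈ 𝐃_j` (`X ⊂ □̃²`).  A frame built from ONE instance (g32's `F12OfRecord Rz cB lam`, instance `lam.idx`) is faithful AT that instance;
the family is then only the ∀ over the residual.  The device below puts the family INSIDE the frame, with an `iff` to the instance-wise statements, so that a consumer who needs
Lemma 4 at all instances of a run (the B13 knit of Theorem 3 uses it along the whole sequence of steps) has ONE leaf to name.

WHAT IS DEFINED ∕ PROVED (kernel bookkeeping, 0 sorry).  §1: `Lemma4Datum P i 𝔸` = the fifteen DATA fields of p07's `Lemma4Data` (no `Prop`); `Lemma4Datum.V ∕ pair ∕ frame 𝓜`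
(p07's `frameOf` body, verbatim, read off the datum; `frame_comp : rfl`); `Lemma4Datum.ofData`, `Lemma4Datum.frame_ofData : (ofData D).frame 𝓜 = frameOf 𝓜 c D` (`rfl`);
`mem_Uprime_frame_of_satisfies`.  §2: THE FAMILY FRAME `frameOfFamily 𝓜 (d : ι → Lemma4Datum)`: `CfgU := ι × (𝐔, 𝐉)`, `CfgA = CfgB := ι × bond functions`, `CfgUJ := Option (ι ×
(𝐔, 𝐉))`; `Uprime ∕ A331 ∕ normB ∕ Ucj` read the tagged instance's own sets; the composite `(V, J(V))` is formed at the common instance when the tags of `𝐔`, `𝐀`, `B′` agree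
(`frameOfFamily_comp_same`), else it is the member `none ∈ Ucj` (`frameOfFamily_comp_ne`, `none_mem_Ucj_frameOfFamily`) — print never composes variables of different instances,
so nothing is asserted there; `analyticOn := ∀ k, (d k).frame.analyticOn`; **`lemma4Printed_frameOfFamily_iff : Lemma4Printed (frameOfFamily 𝓜 d) c ↔ ∀ k, Lemma4Printed
((d k).frame 𝓜) c`** (bookkeeping, located nowhere); `lemma4Printed_frameOfFamily_precomp` (sub-families); `mem_Uprime_frameOfFamily_of_satisfies` (non-vacuity transport).
§3 (record level, over g32's objects): `ResidB12Run.toDatum Rz cB lam` with **`ResidB12Run.frame_toDatum : (lam.toDatum Rz cB).frame (suModel N) = F12OfRecord Rz cB lam`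
(`rfl`)** and `ofData_lemma4DataOfRecord (rfl)`; the FAMILY RESIDUAL `ResidB12Fam P N M` (the letters `𝐊`, `𝐀₂` and the class (3.31) INDEXED by `IdxB12 P M`, the constants
shared — print has one set), `atIdx`, `consts`, `consts_atIdx (rfl)`; `F12FamOfRecord := frameOfFamily (suModel N) (fun ι => (lamF.atIdx ι).toDatum Rz cB)`;
**`B12FamLeafOfRecord Rz cB lamF := Lemma4Printed (F12FamOfRecord …) lamF.consts`** with `b12FamLeafOfRecord_iff : … ↔ ∀ ι, B12LeafOfRecord Rz cB (lamF.atIdx ι)` and the knit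
face `b12FamLeafOfRecord_of_packages : (∀ ι, B12Package Rz cB (lamF.atIdx ι)) → B12FamLeafOfRecord Rz cB lamF` (the companion's `b12LeafOfRecord_of_package` instance-wise);
`nonempty_idxB12`, `nonempty_residB12Fam`; Stage-11 forms `ResidB12Fam₁₁`, `B12FamLeafOfRecord₁₁` (+ `_iff`, `_of_packages`).  NO pin on `θ` here (a `pinB12Fam` replacing
`X.F12` by the family frame is UP-SIDE like g32's `pinB12` and is typed on request only — one pin of record per group at a time).

HONEST FRAMING: definitions + kernel bookkeeping; NO estimate; nothing of [Balaban1987RG1] ∕ [15] asserted; N09 NOT discharged; counts unmoved (5∕28); one finite T⁴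
programme at fixed ε — NOT continuum ∕ ℝ⁴ ∕ infinite volume ∕ OS ∕ mass gap ∕ Clay.  No `sorry`, no `axiom`, no `opaque`, no `instance`, no `notation`.
[cite: Balaban1987RG1, Lemma 4 (3.53) p.280 with (3.26)-(3.52) pp.275-280; §1 (i)-(iv) pp.261-263] -/

open NormedSpace Complex

namespace Literature.MathematicalPhysics.QuantumFieldTheory.Balaban1983to89.Node00

open T4Continuum AveragingRT T4FiniteEpsInhabited FlowStep FlowStepRuns DagBinding T4DatumAssembly
open B12RegularSpaces111 (Frame Region StepConsts Model space space' Satisfies expI mem_space_of_satisfies)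
open B12Eq18Current (ofBackground current)
open B12Lemma4ConcreteFrame (JInputs Lemma4Data frameOf LettersAnalyticAt)
open B12Lemma4Models (slProj)
open B12RegularSpaces111SpecialUnitary (suModel)
open scoped Matrix.Norms.L2Operator

noncomputable section

variable {P : Params} {i : ℕ} {𝔸 : Type} [NormedRing 𝔸] [NormedAlgebra ℂ 𝔸] [CompleteSpace 𝔸]

/-! ## §1. The datum (data only) and its frame -/

/-- **The DATA of Lemma 4 (3.53) for one instance `(k, j, □₀, X)`**, no laws: the frame `F` of `X` at scale `j` with its step constants `cs`,
the frame `F′` of `□₀ = □̃⁵` at scale `k+1` with `cs′`, `Y = □̃³`, the projection `π` of (1.8) with its norm constant `Cπ`, `η = L^{−k}`, `j`,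
`B₃″`, `γ₀′`, the set (3.31) of the fields `𝐀`, `|B′|`, and the total maps `𝐊`, `𝐀₂` — the data fields of `B12Lemma4ConcreteFrame.Lemma4Data`,
verbatim. [cite: Balaban1987RG1, Lemma 4 (3.53) p.280 with (3.26)-(3.52) pp.275-280] -/
structure Lemma4Datum (P : Params) (i : ℕ) (𝔸 : Type) [NormedRing 𝔸] [NormedAlgebra ℂ 𝔸] [CompleteSpace 𝔸] where
  /-- the frame of `X` at scale `j` -/
  F : Frame P i 𝔸
  /-- its step constants (`ξ = L^{−j}`) -/
  cs : StepConsts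
  /-- the frame of `□₀ = □̃⁵` at scale `k+1` -/
  F' : Frame P i 𝔸
  /-- its step constants (`ξ′ = L^{−(k+1)}`) -/
  cs' : StepConsts
  /-- `Y = □̃³` -/
  Y : Region P i
  /-- the projection of (1.8) -/
  π : 𝔸 →ₗ[ℂ] 𝔸
  /-- `‖πX‖ ≤ Cπ‖X‖` -/
  Cπ : ℝ
  /-- `η = L^{−k}` -/
  η : ℝ
  /-- the scale `j` of `X` -/
  j : ℕ
  /-- the constant `B₃″` of (J3) -/
  B₃'' : ℝ
  /-- `γ₀′` -/
  γ₀' : ℝ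
  /-- the set (3.31) of the fields `𝐀` -/
  A331 : Set (PBond P i → 𝔸)
  /-- `|B′|` -/
  normB : (PBond P i → 𝔸) → ℝ
  /-- `𝐊 : (𝐔, 𝐀, τ) ↦ 𝐇_j(□₀, τQ(L⁻¹η𝐇_{k+1}(□₀, (1/i) log V(𝐔))))` -/
  K : FieldPair P i 𝔸ˣ 𝔸 → (PBond P i → 𝔸) → ℝ → PBond P i → 𝔸
  /-- `𝐀₂ : (𝐔, 𝐀, τ, B′) ↦ 𝐀₂` of (3.47)–(3.50) -/
  A₂ : FieldPair P i 𝔸ˣ 𝔸 → (PBond P i → 𝔸) → ℝ → (PBond P i → 𝔸) → PBond P i → 𝔸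

namespace Lemma4Datum

variable (𝓜 : Model 𝔸)

/-- The configuration `V = exp iξ(𝐊(𝐔, 𝐀, τ) + 𝐀₂(𝐔, 𝐀, τ, B′))` of the datum. [cite: Balaban1987RG1, (3.53) p.280] -/
def V (d : Lemma4Datum P i 𝔸) (Φ : FieldPair P i 𝔸ˣ 𝔸) (A : PBond P i → 𝔸) (τ : ℝ) (B' : PBond P i → 𝔸) : PBond P i → 𝔸ˣ :=
  fun b => expI d.cs.ξ (d.K Φ A τ b + d.A₂ Φ A τ B' b)

/-- The composite pair `(V, J(V))` of the datum, `J` the current (1.8) (`B12Eq18Current.ofBackground`). [cite: Balaban1987RG1, (3.53) p.280] -/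
def pair (d : Lemma4Datum P i 𝔸) (Φ : FieldPair P i 𝔸ˣ 𝔸) (A : PBond P i → 𝔸) (τ : ℝ) (B' : PBond P i → 𝔸) : FieldPair P i 𝔸ˣ 𝔸 :=
  ofBackground d.π d.cs.ξ (d.V Φ A τ B')

/-- **The concrete schematic frame of the datum** — the body of `B12Lemma4ConcreteFrame.frameOf`, read off the data: `CfgU = CfgUJ` = pairs
`(𝐔, 𝐉)`, `CfgA = CfgB` = bond functions, `Uprime a₀ a₁ = U′ᶜ_{k+1}(□₀, a₀, a₁, γ₀′)`, `A331`, `normB`, `Ucj α₀ α₁ = Uᶜ_j(X, α₀, α₁)`,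
`comp = (V, J(V))`, `analyticOn` = analyticity of the pair along analytic families of the letters with values in the domain.
[cite: Balaban1987RG1, Lemma 4 (3.53) p.280; §1 (i)-(iv) pp.261-263] -/
def frame (d : Lemma4Datum P i 𝔸) : B12Sec2to5.Lemma4Frame where
  CfgU := FieldPair P i 𝔸ˣ 𝔸
  CfgA := PBond P i → 𝔸
  CfgB := PBond P i → 𝔸
  CfgUJ := FieldPair P i 𝔸ˣ 𝔸
  Uprime a₀ a₁ := space 𝓜 d.F' d.cs' a₀ a₁ d.γ₀'
  A331 := d.A331
  normB := d.normB
  Ucj a₀ a₁ := space' 𝓜 d.F d.cs a₀ a₁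
  comp Φ A τ B' := ofBackground d.π d.cs.ξ (fun b => expI d.cs.ξ (d.K Φ A τ b + d.A₂ Φ A τ B' b))
  analyticOn a₀ a₁ a₃ := ∀ (E : Type) [NormedAddCommGroup E] [NormedSpace ℂ E] (Φf : E → FieldPair P i 𝔸ˣ 𝔸)
    (Af Bf : E → PBond P i → 𝔸) (τ : ℝ) (e₀ : E), LettersAnalyticAt Φf Af Bf e₀ →
      Φf e₀ ∈ space 𝓜 d.F' d.cs' a₀ a₁ d.γ₀' → Af e₀ ∈ d.A331 → 0 ≤ τ → τ ≤ 1 → d.normB (Bf e₀) < a₃ →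
        AnalyticAt ℂ (fun e : E =>
          ((fun b => ((ofBackground d.π d.cs.ξ
              (fun b => expI d.cs.ξ (d.K (Φf e) (Af e) τ b + d.A₂ (Φf e) (Af e) τ (Bf e) b))).U b : 𝔸)),
            (ofBackground d.π d.cs.ξ (fun b => expI d.cs.ξ (d.K (Φf e) (Af e) τ b + d.A₂ (Φf e) (Af e) τ (Bf e) b))).J)) e₀

/-- The composite of the datum's frame is the pair `(V, J(V))`. [cite: Balaban1987RG1, (3.53) p.280] -/
theorem frame_comp (d : Lemma4Datum P i 𝔸) (Φ : FieldPair P i 𝔸ˣ 𝔸) (A : PBond P i → 𝔸) (τ : ℝ) (B' : PBond P i → 𝔸) :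
    (d.frame 𝓜).comp Φ A τ B' = d.pair Φ A τ B' := rfl

variable {𝓜}

/-- A pair satisfying the four conditions of the upper space lies in `Uprime` of the datum's frame (its own orbit) — the frame's printed domain is
inhabited as soon as one such pair is. [cite: Balaban1987RG1, (1.11)-(1.16) p.262] -/
theorem mem_Uprime_frame_of_satisfies (d : Lemma4Datum P i 𝔸) {a₀ a₁ : ℝ} {Φ : FieldPair P i 𝔸ˣ 𝔸}
    (h : Satisfies 𝓜 d.F' d.cs' a₀ a₁ d.γ₀' Φ) : Φ ∈ (d.frame 𝓜).Uprime a₀ a₁ :=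
  mem_space_of_satisfies h

end Lemma4Datum

/-- The data of a package (p07's `Lemma4Data` with its law-fields forgotten). [cite: Balaban1987RG1, Lemma 4 (3.53) p.280] -/
def Lemma4Datum.ofData {𝓜 : Model 𝔸} {c : B12Sec2to5.Lemma4Consts} (D : Lemma4Data P i 𝓜 c) : Lemma4Datum P i 𝔸 where
  F := D.F
  cs := D.cs
  F' := D.F'
  cs' := D.cs'
  Y := D.Y
  π := D.π
  Cπ := D.Cπ
  η := D.η
  j := D.j
  B₃'' := D.B₃''
  γ₀' := D.γ₀'
  A331 := D.A331
  normB := D.normB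
  K := D.K
  A₂ := D.A₂

/-- The frame of a package's data IS p07's concrete frame of the package (`rfl`). [cite: Balaban1987RG1, (3.53) p.280] -/
theorem Lemma4Datum.frame_ofData {𝓜 : Model 𝔸} {c : B12Sec2to5.Lemma4Consts} (D : Lemma4Data P i 𝓜 c) :
    (Lemma4Datum.ofData D).frame 𝓜 = frameOf 𝓜 c D := rfl

/-! ## §2. The family frame: print's «for every k, j ≤ k, □ ∈ π_{k+1}, X ∈ 𝐃_j» as ONE schematic frame -/

section Family

variable (𝓜 : Model 𝔸) {ι : Type}

/-- **The family frame** of an indexed family of data `d : ι → Lemma4Datum` (one schematic `Lemma4Frame` for the whole printed range of Lemma 4):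
a variable `𝐔` ∕ `𝐀` ∕ `B′` is a configuration TAGGED with the instance it belongs to; `Uprime`, `A331`, `normB` read the instance's own sets;
`CfgUJ := Option (ι × (𝐔, 𝐉))` and the composite `(V, J(V))` is formed at the common instance when the three tags agree, else it is the member
`none` (which lies in every `Ucj`); `analyticOn` = the analyticity clause of every instance.  Bookkeeping only — `lemma4Printed_frameOfFamily_iff`.
[cite: Balaban1987RG1, Lemma 4 (3.53) p.280] -/
def frameOfFamily (d : ι → Lemma4Datum P i 𝔸) : B12Sec2to5.Lemma4Frame where
  CfgU := ι × FieldPair P i 𝔸ˣ 𝔸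
  CfgA := ι × (PBond P i → 𝔸)
  CfgB := ι × (PBond P i → 𝔸)
  CfgUJ := Option (ι × FieldPair P i 𝔸ˣ 𝔸)
  Uprime a₀ a₁ := {x | x.2 ∈ space 𝓜 (d x.1).F' (d x.1).cs' a₀ a₁ (d x.1).γ₀'}
  A331 := {a | a.2 ∈ (d a.1).A331}
  normB b := (d b.1).normB b.2
  Ucj a₀ a₁ := {y | ∀ (k : ι) (Ψ : FieldPair P i 𝔸ˣ 𝔸), y = some (k, Ψ) → Ψ ∈ space' 𝓜 (d k).F (d k).cs a₀ a₁}
  comp x a τ b := by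
    classical
    exact if a.1 = x.1 ∧ b.1 = x.1 then some (x.1, (d x.1).pair x.2 a.2 τ b.2) else none
  analyticOn a₀ a₁ a₃ := ∀ k : ι, ((d k).frame 𝓜).analyticOn a₀ a₁ a₃

variable {𝓜}

/-- The composite of the family frame at agreeing tags. [cite: Balaban1987RG1, (3.53) p.280] -/
theorem frameOfFamily_comp_same (d : ι → Lemma4Datum P i 𝔸) (k : ι) (Φ : FieldPair P i 𝔸ˣ 𝔸) (A : PBond P i → 𝔸) (τ : ℝ)
    (B' : PBond P i → 𝔸) :
    (frameOfFamily 𝓜 d).comp (k, Φ) (k, A) τ (k, B') = some (k, (d k).pair Φ A τ B') := by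
  classical
  show (if k = k ∧ k = k then _ else _) = _
  simp

/-- The composite of the family frame at disagreeing tags is the vacuous member `none`. [cite: Balaban1987RG1, (3.53) p.280] -/
theorem frameOfFamily_comp_ne (d : ι → Lemma4Datum P i 𝔸) (x : ι × FieldPair P i 𝔸ˣ 𝔸) (a b : ι × (PBond P i → 𝔸)) (τ : ℝ)
    (h : ¬ (a.1 = x.1 ∧ b.1 = x.1)) : (frameOfFamily 𝓜 d).comp x a τ b = none := by
  classical
  show (if a.1 = x.1 ∧ b.1 = x.1 then _ else _) = _
  simp [h]

/-- `none` lies in every `Ucj` of the family frame. [cite: Balaban1987RG1, (3.53) p.280] -/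
theorem none_mem_Ucj_frameOfFamily (d : ι → Lemma4Datum P i 𝔸) (a₀ a₁ : ℝ) : (none : Option (ι × FieldPair P i 𝔸ˣ 𝔸)) ∈
    (frameOfFamily 𝓜 d).Ucj a₀ a₁ := by
  intro k Ψ h
  exact (Option.some_ne_none _ h.symm).elim

/-- `some (k, Ψ)` lies in `Ucj α₀ α₁` of the family frame iff `Ψ ∈ Uᶜ_j(X, α₀, α₁)` of the instance `k`. [cite: Balaban1987RG1, (3.53) p.280] -/
theorem some_mem_Ucj_frameOfFamily_iff (d : ι → Lemma4Datum P i 𝔸) (a₀ a₁ : ℝ) (k : ι) (Ψ : FieldPair P i 𝔸ˣ 𝔸) :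
    (some (k, Ψ) : Option (ι × FieldPair P i 𝔸ˣ 𝔸)) ∈ (frameOfFamily 𝓜 d).Ucj a₀ a₁ ↔ Ψ ∈ space' 𝓜 (d k).F (d k).cs a₀ a₁ := by
  constructor
  · intro h
    exact h k Ψ rfl
  · rintro h k' Ψ' hk
    obtain ⟨rfl, rfl⟩ := Prod.mk.inj (Option.some.inj hk)
    exact h

/-- **THE FAMILY FRAME IS BOOKKEEPING**: Lemma 4 (3.53) holds on the family frame iff it holds on the frame of every instance.
[cite: Balaban1987RG1, Lemma 4 (3.53) p.280] -/
theorem lemma4Printed_frameOfFamily_iff (d : ι → Lemma4Datum P i 𝔸) (c : B12Sec2to5.Lemma4Consts) :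
    B12Sec2to5.Lemma4Printed (frameOfFamily 𝓜 d) c ↔ ∀ k, B12Sec2to5.Lemma4Printed ((d k).frame 𝓜) c := by
  constructor
  · intro h k hR
    obtain ⟨hm, ha⟩ := h hR
    refine ⟨?_, ha k⟩
    intro Φ A τ B' hΦ hA hτ0 hτ1 hB'
    have hc := hm (k, Φ) (k, A) τ (k, B') hΦ hA hτ0 hτ1 hB'
    rw [frameOfFamily_comp_same] at hc
    exact (some_mem_Ucj_frameOfFamily_iff d _ _ k _).1 hc
  · intro h hR
    refine ⟨?_, fun k => ((h k) hR).2⟩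
    intro x a τ b hx ha hτ0 hτ1 hb
    classical
    by_cases hk : a.1 = x.1 ∧ b.1 = x.1
    · obtain ⟨k, Φ⟩ := x
      obtain ⟨ka, A⟩ := a
      obtain ⟨kb, B'⟩ := b
      obtain ⟨rfl, rfl⟩ := hk
      rw [frameOfFamily_comp_same]
      exact (some_mem_Ucj_frameOfFamily_iff d _ _ _ _).2 (((h _) hR).1 Φ A τ B' hx ha hτ0 hτ1 hb)
    · rw [frameOfFamily_comp_ne d x a b τ hk]
      exact none_mem_Ucj_frameOfFamily d _ _

/-- The family frame's printed domain is inhabited at any instance carrying a pair that satisfies the four conditions of its upper space.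
[cite: Balaban1987RG1, (1.11)-(1.16) p.262] -/
theorem mem_Uprime_frameOfFamily_of_satisfies (d : ι → Lemma4Datum P i 𝔸) (k : ι) {a₀ a₁ : ℝ} {Φ : FieldPair P i 𝔸ˣ 𝔸}
    (h : Satisfies 𝓜 (d k).F' (d k).cs' a₀ a₁ (d k).γ₀' Φ) : ((k, Φ) : ι × FieldPair P i 𝔸ˣ 𝔸) ∈ (frameOfFamily 𝓜 d).Uprime a₀ a₁ :=
  mem_space_of_satisfies h

/-- Lemma 4 on the family frame passes to every sub-family (re-indexing along `e : κ → ι`). [cite: Balaban1987RG1, Lemma 4 (3.53) p.280] -/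
theorem lemma4Printed_frameOfFamily_precomp {κ : Type} (e : κ → ι) (d : ι → Lemma4Datum P i 𝔸) {c : B12Sec2to5.Lemma4Consts}
    (h : B12Sec2to5.Lemma4Printed (frameOfFamily 𝓜 d) c) : B12Sec2to5.Lemma4Printed (frameOfFamily 𝓜 (d ∘ e)) c :=
  (lemma4Printed_frameOfFamily_iff (d ∘ e) c).2 fun k => (lemma4Printed_frameOfFamily_iff d c).1 h (e k)

end Family


/-! ## §3. Over the objects of record: the datum of `ResidB12Run`, the family residual, the family frame and leaf, the knit from packages -/

section Record

variable {P : Params} {N M : ℕ}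

/-- **The datum of Lemma 4 of record** at one instance: g32's frames `frameX ∕ frameBox`, step constants `csX ∕ csBox`, `Y = regionY`, `π = slProj N`, `Cπ = 2`, `η = L⁻ᵏ`, `j`,
`B₃″`, `γ₀′ = α₀`, the class (3.31), `|B′| = ‖B′‖`, the residual letters — the data fields of the companion's `lemma4DataOfRecord`, with no package.
[cite: Balaban1987RG1, Lemma 4 (3.53) p.280; (1.8) p.261, (1.12) p.262] -/
def ResidB12Run.toDatum (Rz : Sect2.Residual P (MatA N)) (cB : ℝ) (lam : ResidB12Run P N M) : Lemma4Datum P 0 (MatA N) where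
  F := lam.frameX Rz
  cs := lam.csX cB
  F' := lam.frameBox Rz
  cs' := lam.csBox cB
  Y := lam.regionY
  π := slProj N
  Cπ := 2
  η := lam.idx.η
  j := lam.idx.j
  B₃'' := lam.B₃''
  γ₀' := lam.α₀
  A331 := lam.A331
  normB B' := ‖B'‖
  K := lam.K
  A₂ := lam.A₂

/-- **The frame of the datum of record IS g32's frame of Lemma 4 of record** (`rfl`). [cite: Balaban1987RG1, Lemma 4 (3.53) p.280 (bookkeeping)] -/
theorem ResidB12Run.frame_toDatum (Rz : Sect2.Residual P (MatA N)) (cB : ℝ) (lam : ResidB12Run P N M) :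
    (lam.toDatum Rz cB).frame (suModel N) = F12OfRecord Rz cB lam := rfl

/-- The data of the companion's package of record are the datum of record (`rfl`). [cite: Balaban1987RG1, Lemma 4 (3.53) p.280 (bookkeeping)] -/
theorem ofData_lemma4DataOfRecord (Rz : Sect2.Residual P (MatA N)) {cB : ℝ} (hcB : 0 < cB) (lam : ResidB12Run P N M) (L : B12Package Rz cB lam) :
    Lemma4Datum.ofData (lemma4DataOfRecord Rz hcB lam L) = lam.toDatum Rz cB := rfl

variable (P N M) in
/-- **THE FAMILY RESIDUAL of the [B12 §§2–5] group, for ONE run**: the [15]-letters `𝐊`, `𝐀₂` and the class (3.31) FOR EVERY instance `(k, j, □, X)` (they depend on `□₀`, `k`, `j`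
in print), and ONE set of constants `B₃, O(1), β₀, β, α₀, …, α₃, B₃″` (print's, uniform in the instance) — data, no law.
[cite: Balaban1987RG1, (3.26)–(3.31) pp.275–276, (3.37) p.277, (3.50) p.280, Lemma 4 p.280] -/
structure ResidB12Fam where
  /-- `𝐊` at the instance -/
  K : IdxB12 P M → FieldPair P 0 (MatA N)ˣ (MatA N) → (PBond P 0 → MatA N) → ℝ → PBond P 0 → MatA N
  /-- `𝐀₂` at the instance -/
  A₂ : IdxB12 P M → FieldPair P 0 (MatA N)ˣ (MatA N) → (PBond P 0 → MatA N) → ℝ → (PBond P 0 → MatA N) → PBond P 0 → MatA N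
  /-- the class (3.31) at the instance -/
  A331 : IdxB12 P M → Set (PBond P 0 → MatA N)
  /-- `B₃, O(1), β₀, β, α₀, α₁, α₂, α₃` and `B₃″` -/
  (B₃ O₁ β₀ β α₀ α₁ α₂ α₃ B₃'' : ℝ)

namespace ResidB12Fam

/-- The one-instance residual at the instance `ι`. [cite: Balaban1987RG1, Lemma 4 p.280 (bookkeeping)] -/
def atIdx (lamF : ResidB12Fam P N M) (ι : IdxB12 P M) : ResidB12Run P N M :=
  ⟨ι, lamF.K ι, lamF.A₂ ι, lamF.A331 ι, lamF.B₃, lamF.O₁, lamF.β₀, lamF.β, lamF.α₀, lamF.α₁, lamF.α₂, lamF.α₃, lamF.B₃''⟩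

/-- The constants of Lemma 4 of the family (`M :=` the cube size of record, `L :=` the block size). [cite: Balaban1987RG1, §3 pp.277–280 («all the restrictions»)] -/
def consts (lamF : ResidB12Fam P N M) : B12Sec2to5.Lemma4Consts :=
  ⟨lamF.B₃, lamF.O₁, (M : ℝ), (P.L : ℝ), lamF.β₀, lamF.β, lamF.α₀, lamF.α₁, lamF.α₂, lamF.α₃⟩

/-- Every instance carries the family's constants (`rfl`). [cite: Balaban1987RG1, Lemma 4 p.280 (bookkeeping)] -/
theorem consts_atIdx (lamF : ResidB12Fam P N M) (ι : IdxB12 P M) : (lamF.atIdx ι).consts = lamF.consts := rfl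

/-- … and its own index (`rfl`). [cite: Balaban1987RG1, Lemma 4 p.280 (bookkeeping)] -/
theorem idx_atIdx (lamF : ResidB12Fam P N M) (ι : IdxB12 P M) : (lamF.atIdx ι).idx = ι := rfl

end ResidB12Fam

/-- **THE FAMILY FRAME OF LEMMA 4 OF RECORD**: ONE schematic frame for every instance `(k, j, □, X)` of the run — the product frame of the data of record.
[cite: Balaban1987RG1, Lemma 4 (3.53) p.280] -/
def F12FamOfRecord (Rz : Sect2.Residual P (MatA N)) (cB : ℝ) (lamF : ResidB12Fam P N M) : B12Sec2to5.Lemma4Frame :=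
  frameOfFamily (suModel N) fun ι => (lamF.atIdx ι).toDatum Rz cB

/-- **THE FAMILY LEAF**: Lemma 4 (3.53) as printed, on the family frame of record, at the family's constants. [cite: Balaban1987RG1, Lemma 4 (3.53) p.280] -/
def B12FamLeafOfRecord (Rz : Sect2.Residual P (MatA N)) (cB : ℝ) (lamF : ResidB12Fam P N M) : Prop :=
  B12Sec2to5.Lemma4Printed (F12FamOfRecord Rz cB lamF) lamF.consts

/-- **THE FAMILY LEAF IS g32's LEAF AT EVERY INSTANCE** (`lemma4Printed_frameOfFamily_iff` + `frame_toDatum`). [cite: Balaban1987RG1, Lemma 4 (3.53) p.280 (bookkeeping)] -/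
theorem b12FamLeafOfRecord_iff (Rz : Sect2.Residual P (MatA N)) (cB : ℝ) (lamF : ResidB12Fam P N M) :
    B12FamLeafOfRecord Rz cB lamF ↔ ∀ ι, B12LeafOfRecord Rz cB (lamF.atIdx ι) :=
  lemma4Printed_frameOfFamily_iff _ _

/-- One instance of the family leaf. [cite: Balaban1987RG1, Lemma 4 (3.53) p.280 (bookkeeping)] -/
theorem b12LeafOfRecord_of_b12FamLeafOfRecord {Rz : Sect2.Residual P (MatA N)} {cB : ℝ} {lamF : ResidB12Fam P N M} (h : B12FamLeafOfRecord Rz cB lamF)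
    (ι : IdxB12 P M) : B12LeafOfRecord Rz cB (lamF.atIdx ι) :=
  (b12FamLeafOfRecord_iff Rz cB lamF).1 h ι

/-- **KNIT FACE OF THE FAMILY LEAF**: the companion's displayed package at every instance gives the family leaf (`b12LeafOfRecord_of_package` instance-wise). NOT a discharge:
the packages are hypotheses. [cite: Balaban1987RG1, Lemma 4 (3.53) p.280] -/
theorem b12FamLeafOfRecord_of_packages [NeZero N] (Rz : Sect2.Residual P (MatA N)) {cB : ℝ} (hcB : 0 < cB) (lamF : ResidB12Fam P N M)
    (L : ∀ ι, B12Package Rz cB (lamF.atIdx ι)) : B12FamLeafOfRecord Rz cB lamF :=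
  (b12FamLeafOfRecord_iff Rz cB lamF).2 fun ι => b12LeafOfRecord_of_package Rz hcB _ (L ι)

/-- The family leaf passes to sub-families (any re-indexing `e : κ → IdxB12`). [cite: Balaban1987RG1, Lemma 4 (3.53) p.280 (bookkeeping)] -/
theorem lemma4Printed_subfamily_of_b12FamLeafOfRecord {Rz : Sect2.Residual P (MatA N)} {cB : ℝ} {lamF : ResidB12Fam P N M} (h : B12FamLeafOfRecord Rz cB lamF)
    {κ : Type} (e : κ → IdxB12 P M) :
    B12Sec2to5.Lemma4Printed (frameOfFamily (suModel N) fun k => (lamF.atIdx (e k)).toDatum Rz cB) lamF.consts :=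
  lemma4Printed_frameOfFamily_precomp e _ h

/-- The instance index is inhabited (`k = j = 1`, the first cube of `π₂`, a single-cube domain of `𝐃₁` — g32's degenerate inhabitant). [cite: Balaban1987RG1, Lemma 4 p.280 (bookkeeping)] -/
theorem nonempty_idxB12 : Nonempty (IdxB12 P M) :=
  ⟨{ k := 1, j := 1, one_le_j := le_rfl, j_le_k := le_rfl, cube := fun _ => 0, X := Sect2.cubeDom P M 1 fun _ => 0 }⟩

/-- The family residual's type is inhabited (zero letters, the whole class, zero constants — NOT objects of record). [cite: Balaban1987RG1, Lemma 4 p.280 (bookkeeping)] -/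
theorem nonempty_residB12Fam : Nonempty (ResidB12Fam P N M) :=
  ⟨{ K := fun _ _ _ _ _ => 0, A₂ := fun _ _ _ _ _ _ => 0, A331 := fun _ => Set.univ,
     B₃ := 0, O₁ := 0, β₀ := 0, β := 0, α₀ := 0, α₁ := 0, α₂ := 0, α₃ := 0, B₃'' := 0 }⟩

/-- The family frame's printed domain is inhabited at every instance whose upper space carries a pair satisfying the four conditions — e.g. the unit pair under def-T's residual laws
(g32's `unitPair_mem_Uprime_of_provisos`, instance-wise). [cite: Balaban1987RG1, (1.11)–(1.16) p.262 (non-vacuity)] -/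
theorem mem_Uprime_F12FamOfRecord_iff (Rz : Sect2.Residual P (MatA N)) (cB : ℝ) (lamF : ResidB12Fam P N M) (ι : IdxB12 P M)
    (Φ : FieldPair P 0 (MatA N)ˣ (MatA N)) (a₀ a₁ : ℝ) :
    ((ι, Φ) : IdxB12 P M × FieldPair P 0 (MatA N)ˣ (MatA N)) ∈ (F12FamOfRecord Rz cB lamF).Uprime a₀ a₁ ↔ Φ ∈ (F12OfRecord Rz cB (lamF.atIdx ι)).Uprime a₀ a₁ :=
  Iff.rfl

end Record

/-! ## §4. At a Stage-11 parameter -/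

section Stage11

variable (F : T4Family) (N : ℕ) [NeZero N]

/-- The family residual over a Stage-11 record: one `ResidB12Fam` per run, on the run's torus, at [I]'s cube size of the record. [cite: Balaban1987RG1, Lemma 4 p.280 (objects of record)] -/
abbrev ResidB12Fam₁₁ (M : ℕ) : Type := ∀ p : B12.RunParams, ResidB12Fam (F.P p.K) N M

omit [NeZero N] in
/-- Its type is inhabited. [cite: Balaban1987RG1, Lemma 4 p.280 (bookkeeping)] -/
theorem nonempty_residB12Fam₁₁ (M : ℕ) : Nonempty (ResidB12Fam₁₁ F N M) :=
  ⟨fun _ => Classical.choice nonempty_residB12Fam⟩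

/-- **The family leaf AT A STAGE-11 PARAMETER**, run `p` (11b's `θ.Rz p.K`, `O(1)LMB := θ.s2.cB`, cube size `θ.τ9.M`). [cite: Balaban1987RG1, Lemma 4 (3.53) p.280] -/
def B12FamLeafOfRecord₁₁ (θ : Stage11Params F N) (lamF : ResidB12Fam₁₁ F N θ.τ9.M) (p : B12.RunParams) : Prop :=
  B12FamLeafOfRecord (θ.Rz p.K) θ.s2.cB (lamF p)

/-- … is g32's Stage-11 leaf at every instance of the run. [cite: Balaban1987RG1, Lemma 4 (3.53) p.280 (bookkeeping)] -/
theorem b12FamLeafOfRecord₁₁_iff (θ : Stage11Params F N) (lamF : ResidB12Fam₁₁ F N θ.τ9.M) (p : B12.RunParams) :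
    B12FamLeafOfRecord₁₁ F N θ lamF p ↔ ∀ ι : IdxB12 (F.P p.K) θ.τ9.M, B12LeafOfRecord (θ.Rz p.K) θ.s2.cB ((lamF p).atIdx ι) :=
  b12FamLeafOfRecord_iff _ _ _

/-- **KNIT FACE at a Stage-11 parameter**: admissibility and the companion's package at every instance give the family leaf. [cite: Balaban1987RG1, Lemma 4 (3.53) p.280] -/
theorem b12FamLeafOfRecord₁₁_of_packages (θ : Stage11Params F N) (hθ : θ.Admissible) (lamF : ResidB12Fam₁₁ F N θ.τ9.M) (p : B12.RunParams)
    (L : ∀ ι : IdxB12 (F.P p.K) θ.τ9.M, B12Package (θ.Rz p.K) θ.s2.cB ((lamF p).atIdx ι)) : B12FamLeafOfRecord₁₁ F N θ lamF p :=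
  b12FamLeafOfRecord_of_packages (θ.Rz p.K) hθ.pos.1 (lamF p) L

/-- The one-instance residual layer of g32's pin READ OFF a family residual and a choice of instance per run — so that g32's `Stage11Params.pinB12` applies verbatim.
[cite: Balaban1987RG1, Lemma 4 p.280 (bookkeeping)] -/
def ResidB12Fam₁₁.atIdx {M : ℕ} (lamF : ResidB12Fam₁₁ F N M) (ι : ∀ p : B12.RunParams, IdxB12 (F.P p.K) M) : ResidB12 F N M :=
  fun p => (lamF p).atIdx (ι p)

/-- The family leaf gives g32's Stage-11 leaf at the chosen instances. [cite: Balaban1987RG1, Lemma 4 (3.53) p.280 (bookkeeping)] -/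
theorem b12LeafOfRecord₁₁_of_b12FamLeafOfRecord₁₁ (θ : Stage11Params F N) (lamF : ResidB12Fam₁₁ F N θ.τ9.M) (ι : ∀ p : B12.RunParams, IdxB12 (F.P p.K) θ.τ9.M)
    (p : B12.RunParams) (h : B12FamLeafOfRecord₁₁ F N θ lamF p) : B12LeafOfRecord₁₁ F N θ (lamF.atIdx F N ι) p :=
  (b12FamLeafOfRecord₁₁_iff F N θ lamF p).1 h (ι p)

end Stage11

end

end Literature.MathematicalPhysics.QuantumFieldTheory.Balaban1983to89.Node00
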